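import Mathlib
import Summits.Langlands.Langlands.Theses.QuadraticWindow
import Summits.Langlands.Langlands.Theorems.QuadraticWindowHostInducedRepInducedPackageAux
import Literature.NumberTheory.Automorphic.AutomorphicInductionCuspidalUnramified
import Literature.NumberTheory.GaloisRepresentations.ArtinCharacterReciprocityProofs
import Literature.NumberTheory.GaloisRepresentations.ArtinReciprocityCharacterProofs

/-!
# Crux `HostInducedRep` (stmt-Langlands-10902), line `grs-explicit-descent`, stub S1
# `stub_inducedPackage`: the induced package `Π = AI_{F/F₀}(π ⊗ ψ')` with control at EVERY guarded
# place, modulo one named fact (`automorphicInduction_cyclic_cuspidal_unramified`), and its two riders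

Supports the crux `Summit.Langlands.Langlands.Theses.QuadraticWindow.HostInducedRep` through the
checked skeleton `Cruxes/HostInducedRep/Lines/grs-explicit-descent.lean` (namespace
`Summit.Langlands.Langlands.Cruxes.HostInducedRep.GrsExplicitDescent`), whose stub S1 reads

    theorem stub_inducedPackage : ∀ F₀ F … τ n hcpt π e k ℓ eψ, Hyps τ n π e k ℓ eψ →
      ∃ PInd : CuspidalAutomorphicRepData (2 * n) F₀ _, IsInducedPackage π eψ PInd ∧
        ¬ (ℓ ∣ disc F₀) ∧ ∀ᶠ v in cofinite, ℓ ∉ v ∧ ∃ α c, Guard π eψ v α c.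

The three predicates `Hyps`, `Guard`, `IsInducedPackage` are redeclared here byte-identically (the
skeleton is not an importable module), so that the skeleton can take them from this file by `Iff.rfl`.

## Inventory of the inputs (what is proved, what is a named fact, what was missing)

* Class field theory for the Artin avatar `eψ : Γ_F → GL_1(ℂ)` — the named fact
  `Literature.NumberTheory.GaloisRepresentations.artinReciprocity_character` is DISCHARGED in the
  tree (`artinReciprocity_character_holds`, `ArtinCharacterReciprocityProofs.lean`): a finite-order
  Hecke character `ψ'` with `ψ'` unramified and `eψ.HasFrobCharpolyAt w (X - C (ψ'(ϖ_w)))` at every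
  `w` where `eψ` is unramified.  PROVED input.
* The twist `π ⊗ ψ'` — `CuspidalAutomorphicRepData.twist` (`AutomorphicTwistBJ.lean`, proved); its
  Satake parameter `α_w · ψ'(ϖ_w)` at EVERY place where `π` and `ψ'` are unramified is proved in the
  Aux file (`hasSatakeParamAt_twist_at_unramified_place`, through a level prime to `w`).  PROVED input.
* Non-Galois-stability of `π ⊗ ψ'` from the crux's `hψnti` — proved here
  (`not_isGaloisStableSatakeAE_twist`).
* Automorphic induction — the tree's named facts `automorphicInduction_cyclic` (Arthur–Clozel
  Thm. 6.2, a.e., not cuspidal) and `automorphicInduction_cyclic_cuspidal` (Thm. 6.2 + Lemma 6.4,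
  a.e., CUSPIDAL, prime degree; `AutomorphicInductionCuspidal.lean`, reduced in
  `AutomorphicInductionCuspidalProofs.lean` to the leaves `ArthurClozel1989_descent_of_galOrbit`,
  `multiplicity_one_gl`) give the Hecke–Satake relation only at ALMOST EVERY place, whereas the stub
  needs it at EVERY guarded place.  MISSING input, vendored (by this line) as the named fact
  `Literature.NumberTheory.Automorphic.automorphicInduction_cyclic_cuspidal_unramified`
  (`AutomorphicInductionCuspidalUnramified.lean`) — the same statement with the relation at every
  place unramified in `E` above which `π` is unramified (Arthur–Clozel Ch. 3, Thm. 4.2 (e) + Thm. 5.1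
  (strong lifting) + Lemma 6.4; Henniart 2012, Thms. 3 and 5) — which refines the a.e. fact
  (`automorphicInduction_cyclic_cuspidal_of_unramified`, proved there).
* Riders — `ℓ ∤ disc F ⇒ ℓ ∤ disc F₀` (`not_dvd_discr_base_of_not_dvd_discr`, Aux file) and "all but
  finitely many `v` are prime to `ℓ` and carry guard data" (`eventually_guard`).  PROVED.

## Main result

`stub_inducedPackage_of_automorphicInduction : automorphicInduction_cyclic_cuspidal_unramified →`
(the registered signature of `stub_inducedPackage`, verbatim).  So S1 is TRUE but, as registered,
provable from the tree only modulo the every-place induction fact: the corrected stub signature is the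
registered one prefixed by `automorphicInduction_cyclic_cuspidal_unramified →`.

References: [ArthurClozelAMS120] Ch. 3 §1 Def. 1.2, Thm. 4.2 (e), Thm. 5.1, §6 Def. 6.1,
Thm. 6.2, Lemma 6.4 (held copy, PDF pp. 171, 173–174, 181, 183–186); [Henniart2012] §1.10,
Thm. 3, Thm. 5, §2.6, Prop. 2.7; [CasselsFrohlichANT1967] Ch. VII §5.1 (A); [FlathCorvallis1979]
Thm. 3.
-/

open scoped BigOperators Polynomial Classical
open Filter Set Function Polynomial IsDedekindDomain NumberField
open Literature.NumberTheory.Automorphic Literature.NumberTheory.GaloisRepresentations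

-- `Summit.Langlands.Langlands.…` (summit = sub-problem name, D-0017 layout) trips `dupNamespace`.
set_option linter.dupNamespace false
set_option autoImplicit false

noncomputable section

namespace Summit.Langlands.Langlands.Theorems.HostInducedRep.GrsExplicitDescent

section Defs

variable {F₀ F : Type} [Field F₀] [NumberField F₀] [Field F] [NumberField F] [Algebra F₀ F]

/-- **The hypotheses of the crux, bundled** (verbatim, in the order of `HostInducedRep`:
`hTR, hdeg, hτ, hreg, hpol, hpar, hodd, hℓ, hunr, hψunr, hψpar, hψnti`). -/
def Hyps (τ : F ≃ₐ[F₀] F) (n : ℕ) {hcpt : isCompact_glFiniteIntegralLevel n F}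
    (π : CuspidalAutomorphicRepData n F hcpt) (e : FramedGaloisRep F₀ ℂ 1) (k : ℤ)
    (ℓ : ℕ) (eψ : FramedGaloisRep F ℂ 1) : Prop :=
  IsTotallyReal F₀ ∧ Module.finrank F₀ F = 2 ∧ τ ≠ 1 ∧ π.1.IsRegularAlgebraic ∧
  (∀ᶠ w in cofinite, ∀ (α β : Multiset ℂ) (c : ℂ), π.1.HasSatakeParamAt w α →
      π.1.HasSatakeParamAt (τ • w) β →
      e.HasFrobCharpolyAt (w.under (𝓞 F₀)) (X - C c) →
      β = α.map (fun a ↦ a⁻¹ * (c * ((w.under (𝓞 F₀)).residueCard : ℂ) ^ k) ^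
        w.asIdeal.inertiaDeg (𝓞 F₀))) ∧
  ((e.restrictField F).IsOdd ∨ ∀ (φ : F →+* ℝ) (c : Field.absoluteGaloisGroup F),
      IsComplexConjugation φ c → Matrix.GeneralLinearGroup.det ((e.restrictField F) c) = 1) ∧
  (Odd n → (e.restrictField F).IsOdd) ∧
  ¬ ((ℓ : ℤ) ∣ NumberField.discr F) ∧
  (∀ w : HeightOneSpectrum (𝓞 F), ((ℓ : ℕ) : 𝓞 F) ∈ w.asIdeal → π.1.IsUnramifiedAt w) ∧
  (∀ w : HeightOneSpectrum (𝓞 F), ((ℓ : ℕ) : 𝓞 F) ∈ w.asIdeal → eψ.IsUnramifiedAt w) ∧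
  (∀ (φ : F →+* ℝ) (c c' : Field.absoluteGaloisGroup F), IsComplexConjugation φ c →
      IsComplexConjugation (φ.comp (τ : F →+* F)) c' →
      Matrix.GeneralLinearGroup.det (eψ c) = Matrix.GeneralLinearGroup.det (eψ c')) ∧
  (∃ᶠ w in cofinite, ∃ (α β : Multiset ℂ) (c c' : ℂ), π.1.HasSatakeParamAt w α ∧
      π.1.HasSatakeParamAt (τ • w) β ∧ eψ.HasFrobCharpolyAt w (X - C c) ∧
      eψ.HasFrobCharpolyAt (τ • w) (X - C c') ∧ β.map (fun b ↦ b * c') ≠ α.map (fun a ↦ a * c))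

/-- **The guard of the crux at a place `v` of `F₀` with data `(α, c)`** (verbatim): every place
`w ∣ v` of `F` is unramified over `F₀`, `π` has Satake parameter `α w` at `w`, and `eψ` is
unramified at `w` with arithmetic-Frobenius value `c w`. -/
def Guard {n : ℕ} {hcpt : isCompact_glFiniteIntegralLevel n F}
    (π : CuspidalAutomorphicRepData n F hcpt) (eψ : FramedGaloisRep F ℂ 1)
    (v : HeightOneSpectrum (𝓞 F₀)) (α : HeightOneSpectrum (𝓞 F) → Multiset ℂ)
    (c : HeightOneSpectrum (𝓞 F) → ℂ) : Prop :=
  ∀ w : HeightOneSpectrum (𝓞 F), w.under (𝓞 F₀) = v →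
    w.asIdeal.ramificationIdx (𝓞 F₀) = 1 ∧ π.1.HasSatakeParamAt w (α w) ∧ eψ.IsUnramifiedAt w ∧
      eψ.HasFrobCharpolyAt w (X - C (c w))

/-- **Induced package**: `Π` (cuspidal on `GL_{2n}/F₀`) has, at EVERY place `v` carrying guard
data `(α, c)`, a Satake parameter whose Satake polynomial is the induced Satake polynomial
`∏_{w ∣ v} ∏_{a ∈ α_w c_w} (X^{f(w∣v)} - a)` (tree `inducedSatakePolynomial`; Arthur–Clozel Ch. 3,
Def. 6.1 (6.1)–(6.2)) — i.e. `Π` looks like `AI_{F/F₀}(π ⊗ ψ')` at every guarded place, not only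
at almost all of them. -/
def IsInducedPackage {n : ℕ} {hcpt : isCompact_glFiniteIntegralLevel n F}
    (π : CuspidalAutomorphicRepData n F hcpt) (eψ : FramedGaloisRep F ℂ 1)
    {hcpt₀ : isCompact_glFiniteIntegralLevel (2 * n) F₀}
    (PInd : CuspidalAutomorphicRepData (2 * n) F₀ hcpt₀) : Prop :=
  ∀ (v : HeightOneSpectrum (𝓞 F₀)) (α : HeightOneSpectrum (𝓞 F) → Multiset ℂ)
    (c : HeightOneSpectrum (𝓞 F) → ℂ), Guard π eψ v α c →
    ∃ B : Multiset ℂ, PInd.1.HasSatakeParamAt v B ∧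
      satakePolynomial B = inducedSatakePolynomial v (fun w ↦ (α w).map (fun a ↦ a * c w))

end Defs

/-! ## The twisted representation `π ⊗ ψ'` is not Galois-stable -/

section Assembly

variable {F₀ F : Type} [Field F₀] [NumberField F₀] [Field F] [NumberField F] [Algebra F₀ F]

/-- **`π ⊗ ψ'` is not `Gal(F/F₀)`-stable in the Satake sense**, from the crux's twist-nontriviality
hypothesis `hψnti`: at infinitely many `w`, `Sat(π, τw)·c_{τw} ≠ Sat(π, w)·c_w` with `c_w` the Frobenius
value of the Artin avatar `eψ`, and `c_w = ψ'(ϖ_w)` by the reciprocity clause `hω` (rank-one Frobenius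
clauses force unramifiedness and are unique), while a Galois-stable `π ⊗ ψ'` would have equal Satake
parameters `ψ'(ϖ_w) Sat(π,w)` at `w` and `τw` almost everywhere (twist formula + uniqueness of Satake
parameters). -/
theorem not_isGaloisStableSatakeAE_twist {n : ℕ} {hcpt : isCompact_glFiniteIntegralLevel n F}
    (π : CuspidalAutomorphicRepData n F hcpt) (eψ : FramedGaloisRep F ℂ 1) (τ : F ≃ₐ[F₀] F)
    {ω : HeckeCharacter F} (hfin : ω.IsFiniteOrder)
    (hω : ∀ w : HeightOneSpectrum (𝓞 F), eψ.IsUnramifiedAt w →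
      ω.IsUnramifiedAt w ∧ eψ.HasFrobCharpolyAt w (X - C (ω.valueAtUniformizer w)))
    (hnti : ∃ᶠ w in cofinite, ∃ (α β : Multiset ℂ) (c c' : ℂ), π.1.HasSatakeParamAt w α ∧
      π.1.HasSatakeParamAt (τ • w) β ∧ eψ.HasFrobCharpolyAt w (X - C c) ∧
      eψ.HasFrobCharpolyAt (τ • w) (X - C c') ∧ β.map (fun b ↦ b * c') ≠ α.map (fun a ↦ a * c)) :
    ¬ IsGaloisStableSatakeAE F₀ (π.twist ω hfin).1 := by
  intro hst
  have htw := π.1.eventually_hasSatakeParamAt_twist hfin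
  have hinj : Function.Injective (fun w : HeightOneSpectrum (𝓞 F) ↦ τ • w) := MulAction.injective τ
  have htw' := hinj.tendsto_cofinite.eventually htw
  obtain ⟨w, ⟨α, β, c, c', hα, hβ, hc, hc', hne⟩, hstw, htww, htww'⟩ :=
    (hnti.and_eventually (hst.and (htw.and htw'))).exists
  have hcω : c = ω.valueAtUniformizer w :=
    artinAvatar_frobValue_unique hc (hω w (artinAvatar_isUnramifiedAt_of_hasFrobCharpolyAt eψ hc)).2
  have hc'ω : c' = ω.valueAtUniformizer (τ • w) :=
    artinAvatar_frobValue_unique hc' (hω _ (artinAvatar_isUnramifiedAt_of_hasFrobCharpolyAt eψ hc')).2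
  have h1 : (π.twist ω hfin).1.HasSatakeParamAt w (α.map (ω.valueAtUniformizer w * ·)) := htww α hα
  have h2 : (π.twist ω hfin).1.HasSatakeParamAt (τ • w)
      (β.map (ω.valueAtUniformizer (τ • w) * ·)) := htww' β hβ
  have h3 : (π.twist ω hfin).1.HasSatakeParamAt (τ • w) (α.map (ω.valueAtUniformizer w * ·)) := by
    refine hstw (τ • w) ?_ _ h1
    rw [← HeightOneSpectrum.under_asIdeal, ← HeightOneSpectrum.under_asIdeal,
      HeightOneSpectrum.under_algEquiv_smul F₀ F τ w]
  have h4 := (π.twist ω hfin).1.hasSatakeParamAt_unique_holds h2 h3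
  refine hne ?_
  rw [hcω, hc'ω]
  calc β.map (fun b ↦ b * ω.valueAtUniformizer (τ • w))
      = β.map (ω.valueAtUniformizer (τ • w) * ·) := Multiset.map_congr rfl fun b _ ↦ mul_comm _ _
    _ = α.map (ω.valueAtUniformizer w * ·) := h4
    _ = α.map (fun a ↦ a * ω.valueAtUniformizer w) := Multiset.map_congr rfl fun a _ ↦ mul_comm _ _

end Assembly


section Main

variable {F₀ F : Type} [Field F₀] [NumberField F₀] [Field F] [NumberField F] [Algebra F₀ F]

/-- **Rider 2: all but finitely many places `v` of `F₀` are prime to `ℓ` and carry guard data**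
(Flath: `π` is unramified above almost every `v`; the Artin avatar `eψ` is unramified almost
everywhere with Frobenius value `ψ'(ϖ_w)` by Artin reciprocity `artinReciprocity_character_holds`;
only finitely many `v` ramify in `F`). -/
theorem eventually_guard {n : ℕ} {hcpt : isCompact_glFiniteIntegralLevel n F}
    (π : CuspidalAutomorphicRepData n F hcpt) (eψ : FramedGaloisRep F ℂ 1) (ℓ : ℕ) [Fact ℓ.Prime] :
    ∀ᶠ v : HeightOneSpectrum (𝓞 F₀) in cofinite, ((ℓ : ℕ) : 𝓞 F₀) ∉ v.asIdeal ∧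
      ∃ (α : HeightOneSpectrum (𝓞 F) → Multiset ℂ) (c : HeightOneSpectrum (𝓞 F) → ℂ),
        Guard π eψ v α c := by
  obtain ⟨ω, -, hω⟩ := artinReciprocity_character_holds F eψ
  have h2 : ∀ᶠ v : HeightOneSpectrum (𝓞 F₀) in cofinite, Algebra.IsUnramifiedIn (𝓞 F) v.asIdeal := by
    filter_upwards [(finite_setOf_not_isUnramifiedIn F₀ F).compl_mem_cofinite] with v hv
    simpa using hv
  have h3 := AutomorphicRepData.eventually_exists_forall_hasSatakeParamAt_above (K := F₀) π.1
  have h4 := eventually_forall_under_eq (F := F₀) (FramedArtinRep.eventually_isUnramifiedAt eψ)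
  filter_upwards [eventually_natCast_not_mem_asIdeal (F₀ := F₀) ℓ, h2, h3, h4] with v hv1 hv2 ⟨α, hα⟩ hv4
  refine ⟨hv1, α, fun w ↦ ω.valueAtUniformizer w, fun w hw ↦ ?_⟩
  have hw' : w.asIdeal.under (𝓞 F₀) = v.asIdeal := (place_under_eq_iff_asIdeal w v).mp hw
  exact ⟨ramificationIdx_eq_one_of_isUnramifiedIn_of_under_eq hv2 hw, hα w hw', hv4 w hw', (hω w (hv4 w hw')).2⟩

/-- **Stub S1 modulo the every-place automorphic-induction fact** — the induced package
`Π = AI_{F/F₀}(π ⊗ ψ')` with control at every guarded place, plus the two riders.  Proof: Artin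
reciprocity (`artinReciprocity_character_holds`, PROVED in the tree) turns the Artin avatar `eψ` into a
finite-order Hecke character `ψ'` with `ψ'(ϖ_w) = c_w` at every place where `eψ` is unramified with
Frobenius value `c_w`; the cuspidal twist `π ⊗ ψ'` (`CuspidalAutomorphicRepData.twist`) has Satake
parameter `α_w c_w` at EVERY such `w` where `π` has parameter `α_w`
(`hasSatakeParamAt_twist_at_unramified_place`: a level of `ψ' ∘ det` prime to `w` exists); `π ⊗ ψ'` is
not Galois-stable (`not_isGaloisStableSatakeAE_twist`, from `hψnti`), so the fact
`automorphicInduction_cyclic_cuspidal_unramified` (Arthur–Clozel Thm. 4.2 (e) + 5.1 + Lemma 6.4 /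
Henniart 2012 Thms. 3, 5) applied to the quadratic (Galois, cyclic, prime-degree) `F/F₀` yields a
cuspidal `Π` on `GL_{2n}/F₀` with the induced Satake polynomial at every place unramified in `F`
above which `π ⊗ ψ'` is unramified — in particular at every guarded place.  Riders:
`not_dvd_discr_base_of_not_dvd_discr`, `eventually_guard`. -/
theorem stub_inducedPackage_of_automorphicInduction :
    automorphicInduction_cyclic_cuspidal_unramified →
    ∀ (F₀ F : Type) [Field F₀] [NumberField F₀] [Field F] [NumberField F] [Algebra F₀ F]
      (τ : F ≃ₐ[F₀] F) (n : ℕ) (hcpt : isCompact_glFiniteIntegralLevel n F)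
      (π : CuspidalAutomorphicRepData n F hcpt) (e : FramedGaloisRep F₀ ℂ 1) (k : ℤ)
      (ℓ : ℕ) [Fact ℓ.Prime] (eψ : FramedGaloisRep F ℂ 1),
      Hyps τ n π e k ℓ eψ →
      ∃ PInd : CuspidalAutomorphicRepData (2 * n) F₀ (isCompact_glFiniteIntegralLevel_holds (2 * n) F₀),
        IsInducedPackage π eψ PInd ∧ ¬ ((ℓ : ℤ) ∣ NumberField.discr F₀) ∧
        ∀ᶠ v : HeightOneSpectrum (𝓞 F₀) in cofinite, ((ℓ : ℕ) : 𝓞 F₀) ∉ v.asIdeal ∧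
          ∃ (α : HeightOneSpectrum (𝓞 F) → Multiset ℂ) (c : HeightOneSpectrum (𝓞 F) → ℂ),
            Guard π eψ v α c := by
  intro hAI F₀ F _ _ _ _ _ τ n hcpt π e k ℓ _ eψ hH
  obtain ⟨-, hdeg, -, -, -, -, -, hℓ, -, -, -, hnti⟩ := hH
  -- the rank is positive (a Satake parameter has `card = n`, and `hψnti` exhibits unequal twists)
  have hn : 0 < n := by
    obtain ⟨w, α, β, c, c', hα, hβ, -, -, hne⟩ := hnti.exists
    by_contra h0
    obtain rfl : n = 0 := Nat.eq_zero_of_not_pos h0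
    exact hne (by rw [Multiset.card_eq_zero.mp hα.card_eq, Multiset.card_eq_zero.mp hβ.card_eq,
      Multiset.map_zero, Multiset.map_zero])
  -- class field theory: the Hecke character `ψ'` of the Artin avatar `eψ`
  obtain ⟨ω, hfin, hω⟩ := artinReciprocity_character_holds F eψ
  -- `F/F₀` is Galois with cyclic group of prime order `2`
  haveI : Algebra.IsQuadraticExtension F₀ F := ⟨hdeg⟩
  haveI : IsGalois F₀ F := Algebra.IsQuadraticExtension.isGalois F₀ F
  have hcyc : IsCyclic (F ≃ₐ[F₀] F) := Algebra.IsQuadraticExtension.isCyclic F₀ F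
  have hprime : (Module.finrank F₀ F).Prime := hdeg ▸ Nat.prime_two
  -- the twist is not Galois-stable, so the induction fact applies (rank `n · [F:F₀] = 2n`)
  have hnst := not_isGaloisStableSatakeAE_twist π eψ τ hfin hω hnti
  have key : ∀ N : ℕ, n * Module.finrank F₀ F = N → ∀ hK : isCompact_glFiniteIntegralLevel N F₀,
      ∃ P : CuspidalAutomorphicRepData N F₀ hK,
        ∀ (v : HeightOneSpectrum (𝓞 F₀)) (β : HeightOneSpectrum (𝓞 F) → Multiset ℂ),
          Algebra.IsUnramifiedIn (𝓞 F) v.asIdeal →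
          (∀ w : HeightOneSpectrum (𝓞 F), w.asIdeal.under (𝓞 F₀) = v.asIdeal →
              (π.twist ω hfin).1.HasSatakeParamAt w (β w)) →
            ∃ α : Multiset ℂ, P.1.HasSatakeParamAt v α ∧
              satakePolynomial α = inducedSatakePolynomial v β := by
    rintro N rfl hK
    exact hAI n F₀ F hcyc hprime hn hcpt hK (π.twist ω hfin) hnst
  obtain ⟨P, hP⟩ := key (2 * n) (by rw [hdeg, mul_comm]) (isCompact_glFiniteIntegralLevel_holds (2 * n) F₀)
  refine ⟨P, fun v α c hg ↦ ?_, not_dvd_discr_base_of_not_dvd_discr hℓ, eventually_guard π eψ ℓ⟩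
  -- the induced package at a guarded place `v`
  have hv : Algebra.IsUnramifiedIn (𝓞 F) v.asIdeal := isUnramifiedIn_of_forall_ramificationIdx_eq_one v fun w hw ↦ (hg w hw).1
  refine hP v (fun w ↦ (α w).map (fun a ↦ a * c w)) hv fun w hw ↦ ?_
  obtain ⟨-, hsat, hunr, hfrob⟩ := hg w ((place_under_eq_iff_asIdeal w v).mpr hw)
  obtain ⟨hωu, hωfrob⟩ := hω w hunr
  have hc : c w = ω.valueAtUniformizer w := artinAvatar_frobValue_unique hfrob hωfrob
  have e : (α w).map (fun a ↦ a * c w) = (α w).map (ω.valueAtUniformizer w * ·) :=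
    Multiset.map_congr rfl fun a _ ↦ by rw [hc, mul_comm]
  rw [e]
  exact hasSatakeParamAt_twist_at_unramified_place hsat hfin hωu

/-- **What the tree's a.e. fact gives** (for the record): from the EXISTING named fact
`automorphicInduction_cyclic_cuspidal` (Arthur–Clozel Thm. 6.2 + Lemma 6.4, relation at almost every
place) the same construction yields a cuspidal `Π` with the induced Satake polynomial at all but
finitely many guarded places — the almost-everywhere shadow of `IsInducedPackage`, which is NOT what
the composition of the line consumes (the patching stub needs every guarded `v ∤ ℓ`).  This pins the
gap between the registered stub and the tree to the passage "almost every place ⟶ every unramified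
place" of the induction fact, i.e. to `automorphicInduction_cyclic_cuspidal_unramified`. -/
theorem inducedPackageAE_of_automorphicInduction_cyclic_cuspidal
    (hAI : automorphicInduction_cyclic_cuspidal) :
    ∀ (F₀ F : Type) [Field F₀] [NumberField F₀] [Field F] [NumberField F] [Algebra F₀ F]
      (τ : F ≃ₐ[F₀] F) (n : ℕ) (hcpt : isCompact_glFiniteIntegralLevel n F)
      (π : CuspidalAutomorphicRepData n F hcpt) (e : FramedGaloisRep F₀ ℂ 1) (k : ℤ)
      (ℓ : ℕ) [Fact ℓ.Prime] (eψ : FramedGaloisRep F ℂ 1),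
      Hyps τ n π e k ℓ eψ →
      ∃ PInd : CuspidalAutomorphicRepData (2 * n) F₀ (isCompact_glFiniteIntegralLevel_holds (2 * n) F₀),
        (∀ᶠ v : HeightOneSpectrum (𝓞 F₀) in cofinite, ∀ (α : HeightOneSpectrum (𝓞 F) → Multiset ℂ)
          (c : HeightOneSpectrum (𝓞 F) → ℂ), Guard π eψ v α c →
          ∃ B : Multiset ℂ, PInd.1.HasSatakeParamAt v B ∧
            satakePolynomial B = inducedSatakePolynomial v (fun w ↦ (α w).map (fun a ↦ a * c w))) ∧
        ¬ ((ℓ : ℤ) ∣ NumberField.discr F₀) ∧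
        ∀ᶠ v : HeightOneSpectrum (𝓞 F₀) in cofinite, ((ℓ : ℕ) : 𝓞 F₀) ∉ v.asIdeal ∧
          ∃ (α : HeightOneSpectrum (𝓞 F) → Multiset ℂ) (c : HeightOneSpectrum (𝓞 F) → ℂ),
            Guard π eψ v α c := by
  intro F₀ F _ _ _ _ _ τ n hcpt π e k ℓ _ eψ hH
  obtain ⟨-, hdeg, -, -, -, -, -, hℓ, -, -, -, hnti⟩ := hH
  have hn : 0 < n := by
    obtain ⟨w, α, β, c, c', hα, hβ, -, -, hne⟩ := hnti.exists
    by_contra h0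
    obtain rfl : n = 0 := Nat.eq_zero_of_not_pos h0
    exact hne (by rw [Multiset.card_eq_zero.mp hα.card_eq, Multiset.card_eq_zero.mp hβ.card_eq,
      Multiset.map_zero, Multiset.map_zero])
  obtain ⟨ω, hfin, hω⟩ := artinReciprocity_character_holds F eψ
  haveI : Algebra.IsQuadraticExtension F₀ F := ⟨hdeg⟩
  haveI : IsGalois F₀ F := Algebra.IsQuadraticExtension.isGalois F₀ F
  have hcyc : IsCyclic (F ≃ₐ[F₀] F) := Algebra.IsQuadraticExtension.isCyclic F₀ F
  have hprime : (Module.finrank F₀ F).Prime := hdeg ▸ Nat.prime_two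
  have hnst := not_isGaloisStableSatakeAE_twist π eψ τ hfin hω hnti
  have key : ∀ N : ℕ, n * Module.finrank F₀ F = N → ∀ hK : isCompact_glFiniteIntegralLevel N F₀,
      ∃ P : CuspidalAutomorphicRepData N F₀ hK, IsAutomorphicInductionAlong (π.twist ω hfin).1 P.1 := by
    rintro N rfl hK
    exact hAI n F₀ F hcyc hprime hn hcpt hK (π.twist ω hfin) hnst
  obtain ⟨P, hP⟩ := key (2 * n) (by rw [hdeg, mul_comm]) (isCompact_glFiniteIntegralLevel_holds (2 * n) F₀)
  refine ⟨P, ?_, not_dvd_discr_base_of_not_dvd_discr hℓ, eventually_guard π eψ ℓ⟩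
  filter_upwards [hP] with v hv α c hg
  refine hv (fun w ↦ (α w).map (fun a ↦ a * c w)) fun w hw ↦ ?_
  obtain ⟨-, hsat, hunr, hfrob⟩ := hg w ((place_under_eq_iff_asIdeal w v).mpr hw)
  obtain ⟨hωu, hωfrob⟩ := hω w hunr
  have hc : c w = ω.valueAtUniformizer w := artinAvatar_frobValue_unique hfrob hωfrob
  have e : (α w).map (fun a ↦ a * c w) = (α w).map (ω.valueAtUniformizer w * ·) :=
    Multiset.map_congr rfl fun a _ ↦ by rw [hc, mul_comm]
  rw [e]
  exact hasSatakeParamAt_twist_at_unramified_place hsat hfin hωu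

end Main

end Summit.Langlands.Langlands.Theorems.HostInducedRep.GrsExplicitDescent

end
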